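import Summits.QuantumFields.BalabanUV.Beta.GAN24.CombChargeRowsOfFaceShapes
import Summits.QuantumFields.BalabanUV.Beta.GAN24.CombFaceReadCrossedValuesAn1

/-!
# `BalabanUV.Beta.GAN24.CombChargeRowsClosed` — binder row G-an2-4 ∕ (CONV-C), TRANSFER-III, the (III′) (C)-row's END at row D1's literal of record: **THE G-an2-4 END ⟸ (b) ∧ W-an2-1′ —
# EVERY FORCING-SIDE DISPLAY GONE** — this gen's Q `CombChargeRowsOfFaceShapes` (END ⟸ (b) ∧ `hface` ∧ `hface0` ∧ `hWn` ∧ `hcell` ∧ W-an2-1′) with the four supplier letters SUPPLIED BY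
# NAME by gan24-formalise-leaf-01 g88's `CombFaceReadCrossedValuesAn1` (`hface_comb_an1`, `hface0_comb_an1`, `hcell_comb_an1` — the comb-data twins of leaf-06's `FaceReadCrossedValue*`
# value files with road-P2's explicit pattern letters `G k n a b := Lc^(8+8k)·PAIRSUM_k(P n)(a,b)`, `W m a b := −4·Lc⁸·((Lc·P m)² − 1)`, pins folded) and the Wilson number `hWn` by the spine
# END's `field_simp; ring`; the periods pinned `P m := Lc^(m+1)`.  WHAT THE G-an2-4 SIDE OF THE (III′) END STILL DISPLAYS AFTER THIS FILE: (b) the S-slot rows of `ScombOf` (road-P2's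
# S-campaign; NOT asked, an2 W-4) and (iii) an2's quartic reflection law W-an2-1′ (letters `γ h R2`, Q-GAN24P1-51-1) — NOTHING on the forcing ∕ charge side
# (G-an2-4 ∕ (CONV-C) OWNER `b2b-balaban-gan24-p1`, gen 53; journal [GAN24P1-G53-INTENT-7])

NOT IN PRINT; OUR BOOKKEEPING ([folklore] one composition BY NAME: Q ∘ leaf-01 g88 An1 ∘ `field_simp; ring`; 0 `def`, 0 cited fact, 0 `def … : Prop`, 0 sorry).
HONEST FRAMING (cell contract, verbatim): «discharging `BetaPertH` makes Bałaban's UV stability UNCONDITIONAL — a real constructive-QFT result; it is NOT the continuum limit and NOT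
the Clay problem.»  HONEST DEPENDENCY (verbatim): «continuum YM on T⁴ ⇐ BetaPertH ∧ nine spine estimates (0/9 proved); BetaPertH ⇐ (D1) ∧ (D4) ∧ CAP+tail; G-an2-4 gates asym, D1
and NE2/3/4.»

WHAT (at an1's record of (III′): `Odd Lc`, `2 ≤ Lc`, `2 ≤ N`, `cΛ·Lc⁴ = 2`, `cB = −Lc¹²∕4`; (b) `hS`∕`hSall`; (iii) `hlaw` with letters `γ h R2`):
**`exists_allScalesSeq_JsB12CombShSym_an1_of_sRows_law`** — road FP's D1 literal `∃ κ θ<1, AllScalesSeq (j ↦ secondMoment (TbalOf Lc (JsB12CombShSym hLc N (symTablesAn1S2 3 Lc cΛ) cΛ cB) j) μ ν) κ θ`;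
**`d1Drift_JsB12CombShSym_an1_iff_lim_eq_of_sRows_law`** — row D1's reading.  Asserts NO value of Bałaban's tables beyond an2's ∕ an1's DEFINED ones; (b) and W-an2-1′ remain
HYPOTHESES; NEVER «G-an2-4 closed» as (CONV-C); NOT D1, NOT `BetaPertH`, NOT continuum, NOT Clay.  2026-08-27; no existing file touched.
-/

noncomputable section

open Finset
open scoped BigOperators
open Literature.MathematicalPhysics.QuantumFieldTheory
open Literature.MathematicalPhysics.QuantumFieldTheory.Balaban1983to89
open Literature.MathematicalPhysics.QuantumFieldTheory.Balaban1983to89.Beta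
open ExpKernelCalculus (MKer shiftK)
open OneStepResolventKernel (Fib LocStencil)
open OneStepKernelFamily (TbalOf D1Drift)
open RemainderConstAllScales (AllScalesSeq)
open BalabanCompositeJets (LocStencil₂)
open PolarizationSign (reflSign)
open KernelReflection (refK)
open ResolventReflection (bref Φ)
open WilsonVertex2Sym (wsym22)
open SecondOrderResponse (W2SymOfK)
open BalabanStepJetsSucc (mmRead)
open BalabanStepW2 (K3OfK M2Of)
open Summit.QuantumFields.BalabanUV.Beta.TameKernelCalculus (trK)
open Summit.QuantumFields.BalabanUV.Beta.ChartConjugation (conjV conjW)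
open Summit.QuantumFields.BalabanUV.Beta.BorderedHessian (diagK sgnK bhK)
open Summit.QuantumFields.BalabanUV.Beta.HessKerDressedUnits (unitK unitS)
open Summit.QuantumFields.BalabanUV.Beta.SecondOrderUnits (unitM unitM₂ unitS₂)
open Summit.QuantumFields.BalabanUV.Beta.SymShiftedSpread (bhKStepSh)
open Summit.QuantumFields.BalabanUV.Beta.E3ContactGenerator (ctGenM)
open Summit.QuantumFields.BalabanUV.Beta.DshAn1 (Dsh)
open Summit.QuantumFields.BalabanUV.Beta.SpineRooted (T2RecOf)
open Summit.QuantumFields.BalabanUV.Beta.CombChartStepJets (GcombSh ScombOf SpureCombOf)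
open Summit.QuantumFields.BalabanUV.Beta.SymSecondOrderTablesAn1 (symTablesAn1S2)
open Summit.QuantumFields.BalabanUV.Beta.CombChartJointEnd (JsB12CombShSym)
open Summit.QuantumFields.BalabanUV.Beta.GAN24.CombesThomas (sfStep smStep)
open Summit.QuantumFields.BalabanUV.Beta.GAN24.BiStencilZeroMode (Tab zmode)
open Summit.QuantumFields.BalabanUV.Beta.GAN24.CombChartChargeEvenClassRow (zsymLegSymEven_of_crossed_an1)
open Summit.QuantumFields.BalabanUV.Beta.GAN24.CombChartParityOddOfQuarticLaw (zmode_unitS₂_T2RecOf_combChart_an1_add_legSwap_eq_zero_of_law)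
open Summit.QuantumFields.BalabanUV.Beta.GAN24.CombChargeConservationRowLegSym (exists_allScalesSeq_JsB12CombShSym_an1_of_sRows_legBondSymConserved
  d1Drift_JsB12CombShSym_an1_iff_lim_eq_of_sRows_legBondSymConserved)

open AffineAveraging (Site box toSite)
open Summit.QuantumFields.BalabanUV.Beta.GAN24.CombChargeConservationRowAssembled (legBondSym_conserved_of_pairForm_crossed_law_levelZero
  exists_allScalesSeq_JsB12CombShSym_an1_of_sRows_pairForm_crossed_law_levelZero d1Drift_JsB12CombShSym_an1_iff_lim_eq_of_sRows_pairForm_crossed_law_levelZero)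
open Summit.QuantumFields.BalabanUV.Beta.GAN24.CombChartChargeTowerCrossed (crossedConserved_iff_forcingCrossed_pin)
open Summit.QuantumFields.BalabanUV.Beta.GAN24.CombChartChargeLevelZeroEvenRow (legBondSymEven_levelZero_of_forcingPairForm_forcingCrossed)

open AffineAveraging (Site box toSite)
open Summit.QuantumFields.BalabanUV.Beta.GAN24.CombChargeConservationRowForcingSide (exists_allScalesSeq_JsB12CombShSym_an1_of_sRows_pairForm_forcingCrossed_law
  d1Drift_JsB12CombShSym_an1_iff_lim_eq_of_sRows_pairForm_forcingCrossed_law)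
open Summit.QuantumFields.BalabanUV.Beta.GAN24.CombChartChargeTowerCrossed (crossedConserved_iff_forcingCrossed_pin)
open Summit.QuantumFields.BalabanUV.Beta.GAN24.CombChartCrossedLedgerFirstStep (forcingCrossed_levelZero_iff_value_pin)
open Summit.QuantumFields.BalabanUV.Beta.GAN24.CombChartCrossedLedgerForcingCell (crossedConserved_iff_cellLaw_of_levelZeroValue_wilson_pin)

open Summit.QuantumFields.BalabanUV.Beta.GAN24.CombChargeConservationRowCellLaw (exists_allScalesSeq_JsB12CombShSym_an1_of_sRows_pairForm_cellLaw_law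
  d1Drift_JsB12CombShSym_an1_iff_lim_eq_of_sRows_pairForm_cellLaw_law)
open Summit.QuantumFields.BalabanUV.Beta.GAN24.CombForcingPairFormLevelZero (pairFormLS_combForcing_level0_lit crossed_zmode_combForcing_level0_pin)
open Summit.QuantumFields.BalabanUV.Beta.GAN24.CombForcingPairFormSucc (pairFormLS_combForcing_succ_an1_of_pairForm)
open Summit.QuantumFields.BalabanUV.Beta.GAN24.CombExitFaceCurrentCellTotalsAn1 (comb_sum_box_current_E_eq_zero_an1)
open Summit.QuantumFields.BalabanUV.Beta.GAN24.CombExchangeESectorPairFormAn1 (exists_pairForm_comb_eeWords_an1)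

open BalabanStepJetsSucc (E2)
open Summit.QuantumFields.BalabanUV.Beta.GAN24.CombChargeRowsOfFaceShapes (exists_allScalesSeq_JsB12CombShSym_an1_of_sRows_faceShapes_cellLaw_law
  d1Drift_JsB12CombShSym_an1_iff_lim_eq_of_sRows_faceShapes_cellLaw_law)
open Summit.QuantumFields.BalabanUV.Beta.GAN24.CombFaceReadCrossedValuesAn1 (hface_comb_an1 hface0_comb_an1 hcell_comb_an1)

namespace Summit.QuantumFields.BalabanUV.Beta.GAN24.CombChargeRowsClosed

variable {Lc : ℕ} [NeZero Lc]

set_option maxHeartbeats 1000000 in  -- the supplied face-shape letters are large terms, as Q ∕ G52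
set_option maxRecDepth 2048 in
/-- NOT IN PRINT; OUR BOOKKEEPING.  **THE G-an2-4 END AT ROW D1's LITERAL OF RECORD (III′) FROM (b) AND W-an2-1′ ALONE** — Q with `hface ∕ hface0 ∕ hcell := leaf-01 g88 An1`,
`hWn := field_simp; ring`, `P m := Lc^(m+1)`, road-P2's explicit `G`, `W`. -/
theorem exists_allScalesSeq_JsB12CombShSym_an1_of_sRows_law (hLc : Odd Lc) (hLc2 : 2 ≤ Lc) {N : ℕ} (hN : 2 ≤ N) {cΛ cB : ℝ} (hΛ : cΛ * (Lc : ℝ) ^ 4 = 2) (hcB : cB = -((Lc : ℝ) ^ 12 / 4))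
    {Cs cS θS δS : ℝ}
    (hS : ∀ j, LocStencil (unitS (sfStep Lc j) (smStep 3 Lc j) (ScombOf (symTablesAn1S2 3 Lc cΛ) ((Lc : ℝ) ^ 4) (-((Lc : ℝ) ^ 8 / 2)) cΛ j)) Cs δS)
    (hSall : ∀ k j, LocStencil (unitS (sfStep Lc (k + j)) (smStep 3 Lc (k + j)) (ScombOf (symTablesAn1S2 3 Lc cΛ) ((Lc : ℝ) ^ 4) (-((Lc : ℝ) ^ 8 / 2)) cΛ (k + j)) -
      unitS (sfStep Lc k) (smStep 3 Lc k) (ScombOf (symTablesAn1S2 3 Lc cΛ) ((Lc : ℝ) ^ 4) (-((Lc : ℝ) ^ 8 / 2)) cΛ k)) (cS * θS ^ k) δS)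
    (hδS : 0 < δS) (hθS0 : 0 ≤ θS) (hθS1 : θS < 1)
    -- (iii) W-an2-1′: an2's QUARTIC REFLECTION LAW OF THE COMB-CHART MEMBER AT EVERY LEVEL, in comb letters (ASK an2; `SpineRecursiveT2AllComb` proves it from table letters)
    (γ : ℕ → ℝ)
    (h : ℕ → Fin 4 → Fin 4 → (Fin 4 → ℤ) → Fin 4 → (Fin 4 → ℤ) → (Fin 4 → ℤ) → Fib 3 → ℝ)
    (hhL : ∀ (j : ℕ) (α : Fin 4), ∃ C δ : ℝ, 0 < δ ∧ LocStencil₂ (fun κ u κ' u' => diagK (h j α κ u κ' u')) C δ)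
    (hh : ∀ (j : ℕ) (α κ : Fin 4) (u : Fin 4 → ℤ) (κ' : Fin 4) (u' : Fin 4 → ℤ), ∃ s : Finset (Fin 4 → ℤ), ∀ x ∉ s, ∀ (β : Fin 4), h j α κ u κ' u' x (Sum.inl β) = 0)
    (R2 : ℕ → Fin 4 → Fin 4 → (Fin 4 → ℤ) → Fin 4 → (Fin 4 → ℤ) → MKer 4 (Fib 3))
    (hR2c : ∀ (j : ℕ) (α : Fin 4), ∃ C δ : ℝ, 0 < δ ∧ LocStencil₂ (R2 j α) C δ)
    (hR2p : ∀ (j : ℕ) (α : Fin 4) κ u κ' u', trK (R2 j α κ u κ' u') = -sgnK (R2 j α κ u κ' u'))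
    (hlaw : ∀ (j : ℕ) (α κ : Fin 4) (u : Fin 4 → ℤ) (κ' : Fin 4) (u' : Fin 4 → ℤ),
      T2RecOf 3 Lc (GcombSh Lc) (SpureCombOf (symTablesAn1S2 3 Lc cΛ) ((Lc : ℝ) ^ 4) (-((Lc : ℝ) ^ 8 / 2)) cΛ) (symTablesAn1S2 3 Lc cΛ).M ((Lc : ℝ) ^ 8) cB ((8 * (N : ℝ) ^ 2)⁻¹ • wsym22 N)
          (symTablesAn1S2 3 Lc cΛ).vh₂S (symTablesAn1S2 3 Lc cΛ).mixFF j κ (bref α κ u) κ' (bref α κ' u') =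
        (reflSign α κ * reflSign α κ') • refK (Φ Lc α)
          (T2RecOf 3 Lc (GcombSh Lc) (SpureCombOf (symTablesAn1S2 3 Lc cΛ) ((Lc : ℝ) ^ 4) (-((Lc : ℝ) ^ 8 / 2)) cΛ) (symTablesAn1S2 3 Lc cΛ).M ((Lc : ℝ) ^ 8) cB ((8 * (N : ℝ) ^ 2)⁻¹ • wsym22 N)
              (symTablesAn1S2 3 Lc cΛ).vh₂S (symTablesAn1S2 3 Lc cΛ).mixFF j κ u κ' u' +
            conjW (bhKStepSh 3 Lc (Dsh Lc) j)
              (SpureCombOf (symTablesAn1S2 3 Lc cΛ) ((Lc : ℝ) ^ 4) (-((Lc : ℝ) ^ 8 / 2)) cΛ j κ u)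
              (SpureCombOf (symTablesAn1S2 3 Lc cΛ) ((Lc : ℝ) ^ 4) (-((Lc : ℝ) ^ 8 / 2)) cΛ j κ' u')
              (diagK fun p a => γ j * ctGenM 3 (bhK Lc + Dsh Lc) α Lc κ u p a) (diagK fun p a => γ j * ctGenM 3 (bhK Lc + Dsh Lc) α Lc κ' u' p a)
              (diagK (h j α κ u κ' u')) +
            R2 j α κ u κ' u'))
    (μ ν : Fin 4) :
    ∃ κ θ : ℝ, 0 ≤ θ ∧ θ < 1 ∧ AllScalesSeq (fun j => B12Beta.secondMoment (TbalOf Lc (JsB12CombShSym hLc N (symTablesAn1S2 3 Lc cΛ) cΛ cB) j) μ ν) κ θ := by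
  have hLc3 : 3 ≤ Lc := by obtain ⟨k, hk⟩ := hLc; omega
  have hNr : (N : ℝ) ≠ 0 := Nat.cast_ne_zero.mpr (by omega)
  have hL : (Lc : ℝ) ≠ 0 := Nat.cast_ne_zero.mpr (NeZero.ne Lc)
  -- the periods of the face reads: `P m = Lc^(m+1)`
  set P : ℕ → ℕ := fun m => Lc ^ (m + 1) with hPdef
  have hP0 : P 0 = Lc := by simp [hPdef]
  have hPs : ∀ m, P (m + 1) = Lc * P m := fun m => by simp [hPdef, pow_succ]; ring
  have hWn : ∀ (a b : Fin (3 + 1)), a ≠ b → ∀ m : ℕ,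
      (fun (m : ℕ) (a₀ b₀ : Fin (3 + 1)) => -4 * (Lc : ℝ) ^ 8 * ((((Lc * P m : ℕ) : ℝ)) ^ 2 - 1)) m a b
        = -4 * (Lc : ℝ) ^ 8 * ((Lc : ℝ) ^ 2 - 1) - 32 * (N : ℝ) ^ 2 * (Lc : ℝ) ^ 8 * (8 * (N : ℝ) ^ 2)⁻¹ * (Lc : ℝ) ^ 2 * (((P m : ℕ) : ℝ) ^ 2 - 1) := by
    intro a b _ m
    show -4 * (Lc : ℝ) ^ 8 * ((((Lc * P m : ℕ) : ℝ)) ^ 2 - 1) = _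
    push_cast
    field_simp
    ring
  exact exists_allScalesSeq_JsB12CombShSym_an1_of_sRows_faceShapes_cellLaw_law hLc hLc2 hN hΛ hcB hS hSall hδS hθS0 hθS1 P hP0 hPs
    (fun (k n : ℕ) (a₀ b₀ : Fin (3 + 1)) => ((Lc : ℝ) ^ (8 + 8 * k) * ((∑ yy ∈ box (3 + 1) (P n), ∑ al : Fin (3 + 1),
              ((if al = b₀ then ((((P n : ℕ) : ℝ))⁻¹ * (((P n : ℕ) : ℝ))⁻¹) * ((((toSite yy a₀ % ((P n : ℕ) : ℤ)) : ℤ) : ℝ) - (((P n : ℕ) : ℝ) - 1) / 2) else 0)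
                + (if al = a₀ then (-(((P n : ℕ) : ℝ))⁻¹ * ((((toSite yy b₀ % ((P n : ℕ) : ℤ)) : ℤ) : ℝ) - (((P n : ℕ) : ℝ) - 1) / 2)) *
                    (if toSite yy a₀ % ((P n : ℕ) : ℤ) = ((P n : ℕ) : ℤ) - 1 then (1 : ℝ) else 0) else 0)) *
              ∑' ss : Site (3 + 1), ∑ bl : Fin (3 + 1), E2 3 Lc k (toSite yy) ss (Sum.inl al) (Sum.inl bl) *
                ((if bl = a₀ then ((((P n : ℕ) : ℝ))⁻¹ * (((P n : ℕ) : ℝ))⁻¹) * ((((ss b₀ % ((P n : ℕ) : ℤ)) : ℤ) : ℝ) - (((P n : ℕ) : ℝ) - 1) / 2) else 0)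
                  + (if bl = b₀ then (-(((P n : ℕ) : ℝ))⁻¹ * ((((ss a₀ % ((P n : ℕ) : ℤ)) : ℤ) : ℝ) - (((P n : ℕ) : ℝ) - 1) / 2)) *
                      (if ss b₀ % ((P n : ℕ) : ℤ) = ((P n : ℕ) : ℤ) - 1 then (1 : ℝ) else 0) else 0)))
            + (∑ yy ∈ box (3 + 1) (P n), ∑ al : Fin (3 + 1),
              ((if al = a₀ then ((((P n : ℕ) : ℝ))⁻¹ * (((P n : ℕ) : ℝ))⁻¹) * ((((toSite yy b₀ % ((P n : ℕ) : ℤ)) : ℤ) : ℝ) - (((P n : ℕ) : ℝ) - 1) / 2) else 0)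
                + (if al = b₀ then (-(((P n : ℕ) : ℝ))⁻¹ * ((((toSite yy a₀ % ((P n : ℕ) : ℤ)) : ℤ) : ℝ) - (((P n : ℕ) : ℝ) - 1) / 2)) *
                    (if toSite yy b₀ % ((P n : ℕ) : ℤ) = ((P n : ℕ) : ℤ) - 1 then (1 : ℝ) else 0) else 0)) *
              ∑' ss : Site (3 + 1), ∑ bl : Fin (3 + 1), E2 3 Lc k (toSite yy) ss (Sum.inl al) (Sum.inl bl) *
                ((if bl = b₀ then ((((P n : ℕ) : ℝ))⁻¹ * (((P n : ℕ) : ℝ))⁻¹) * ((((ss a₀ % ((P n : ℕ) : ℤ)) : ℤ) : ℝ) - (((P n : ℕ) : ℝ) - 1) / 2) else 0)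
                  + (if bl = a₀ then (-(((P n : ℕ) : ℝ))⁻¹ * ((((ss b₀ % ((P n : ℕ) : ℤ)) : ℤ) : ℝ) - (((P n : ℕ) : ℝ) - 1) / 2)) *
                      (if ss a₀ % ((P n : ℕ) : ℤ) = ((P n : ℕ) : ℤ) - 1 then (1 : ℝ) else 0) else 0))))))
    (fun (m : ℕ) (a₀ b₀ : Fin (3 + 1)) => -4 * (Lc : ℝ) ^ 8 * ((((Lc * P m : ℕ) : ℝ)) ^ 2 - 1))
    (fun a b hab k m => hface_comb_an1 cΛ cB hP0 hPs a b hab k m) (fun a b hab m => hface0_comb_an1 cΛ cB hP0 hPs a b hab m) hWn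
    (fun a b hab i => hcell_comb_an1 hLc hLc3 cΛ cB hP0 a b hab i) γ h hhL hh R2 hR2c hR2p hlaw μ ν

set_option maxHeartbeats 1000000 in
set_option maxRecDepth 2048 in
/-- NOT IN PRINT; OUR BOOKKEEPING.  **ROW D1's READING FROM (b) AND W-an2-1′** (the VALUE `lim β = stepBal Nc Lc` is row D1's and is NOT proved). -/
theorem d1Drift_JsB12CombShSym_an1_iff_lim_eq_of_sRows_law (hLc : Odd Lc) (hLc2 : 2 ≤ Lc) {N : ℕ} (hN : 2 ≤ N) {cΛ cB : ℝ} (hΛ : cΛ * (Lc : ℝ) ^ 4 = 2) (hcB : cB = -((Lc : ℝ) ^ 12 / 4))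
    {Cs cS θS δS : ℝ}
    (hS : ∀ j, LocStencil (unitS (sfStep Lc j) (smStep 3 Lc j) (ScombOf (symTablesAn1S2 3 Lc cΛ) ((Lc : ℝ) ^ 4) (-((Lc : ℝ) ^ 8 / 2)) cΛ j)) Cs δS)
    (hSall : ∀ k j, LocStencil (unitS (sfStep Lc (k + j)) (smStep 3 Lc (k + j)) (ScombOf (symTablesAn1S2 3 Lc cΛ) ((Lc : ℝ) ^ 4) (-((Lc : ℝ) ^ 8 / 2)) cΛ (k + j)) -
      unitS (sfStep Lc k) (smStep 3 Lc k) (ScombOf (symTablesAn1S2 3 Lc cΛ) ((Lc : ℝ) ^ 4) (-((Lc : ℝ) ^ 8 / 2)) cΛ k)) (cS * θS ^ k) δS)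
    (hδS : 0 < δS) (hθS0 : 0 ≤ θS) (hθS1 : θS < 1)
    -- (iii) W-an2-1′: an2's QUARTIC REFLECTION LAW OF THE COMB-CHART MEMBER AT EVERY LEVEL, in comb letters (ASK an2; `SpineRecursiveT2AllComb` proves it from table letters)
    (γ : ℕ → ℝ)
    (h : ℕ → Fin 4 → Fin 4 → (Fin 4 → ℤ) → Fin 4 → (Fin 4 → ℤ) → (Fin 4 → ℤ) → Fib 3 → ℝ)
    (hhL : ∀ (j : ℕ) (α : Fin 4), ∃ C δ : ℝ, 0 < δ ∧ LocStencil₂ (fun κ u κ' u' => diagK (h j α κ u κ' u')) C δ)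
    (hh : ∀ (j : ℕ) (α κ : Fin 4) (u : Fin 4 → ℤ) (κ' : Fin 4) (u' : Fin 4 → ℤ), ∃ s : Finset (Fin 4 → ℤ), ∀ x ∉ s, ∀ (β : Fin 4), h j α κ u κ' u' x (Sum.inl β) = 0)
    (R2 : ℕ → Fin 4 → Fin 4 → (Fin 4 → ℤ) → Fin 4 → (Fin 4 → ℤ) → MKer 4 (Fib 3))
    (hR2c : ∀ (j : ℕ) (α : Fin 4), ∃ C δ : ℝ, 0 < δ ∧ LocStencil₂ (R2 j α) C δ)
    (hR2p : ∀ (j : ℕ) (α : Fin 4) κ u κ' u', trK (R2 j α κ u κ' u') = -sgnK (R2 j α κ u κ' u'))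
    (hlaw : ∀ (j : ℕ) (α κ : Fin 4) (u : Fin 4 → ℤ) (κ' : Fin 4) (u' : Fin 4 → ℤ),
      T2RecOf 3 Lc (GcombSh Lc) (SpureCombOf (symTablesAn1S2 3 Lc cΛ) ((Lc : ℝ) ^ 4) (-((Lc : ℝ) ^ 8 / 2)) cΛ) (symTablesAn1S2 3 Lc cΛ).M ((Lc : ℝ) ^ 8) cB ((8 * (N : ℝ) ^ 2)⁻¹ • wsym22 N)
          (symTablesAn1S2 3 Lc cΛ).vh₂S (symTablesAn1S2 3 Lc cΛ).mixFF j κ (bref α κ u) κ' (bref α κ' u') =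
        (reflSign α κ * reflSign α κ') • refK (Φ Lc α)
          (T2RecOf 3 Lc (GcombSh Lc) (SpureCombOf (symTablesAn1S2 3 Lc cΛ) ((Lc : ℝ) ^ 4) (-((Lc : ℝ) ^ 8 / 2)) cΛ) (symTablesAn1S2 3 Lc cΛ).M ((Lc : ℝ) ^ 8) cB ((8 * (N : ℝ) ^ 2)⁻¹ • wsym22 N)
              (symTablesAn1S2 3 Lc cΛ).vh₂S (symTablesAn1S2 3 Lc cΛ).mixFF j κ u κ' u' +
            conjW (bhKStepSh 3 Lc (Dsh Lc) j)
              (SpureCombOf (symTablesAn1S2 3 Lc cΛ) ((Lc : ℝ) ^ 4) (-((Lc : ℝ) ^ 8 / 2)) cΛ j κ u)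
              (SpureCombOf (symTablesAn1S2 3 Lc cΛ) ((Lc : ℝ) ^ 4) (-((Lc : ℝ) ^ 8 / 2)) cΛ j κ' u')
              (diagK fun p a => γ j * ctGenM 3 (bhK Lc + Dsh Lc) α Lc κ u p a) (diagK fun p a => γ j * ctGenM 3 (bhK Lc + Dsh Lc) α Lc κ' u' p a)
              (diagK (h j α κ u κ' u')) +
            R2 j α κ u κ' u'))
    (μ ν : Fin 4) (Nc : ℝ) :
    D1Drift Lc (JsB12CombShSym hLc N (symTablesAn1S2 3 Lc cΛ) cΛ cB) Nc μ ν ↔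
      RateCertificate.CauchyRate.lim (fun j => B12Beta.secondMoment (TbalOf Lc (JsB12CombShSym hLc N (symTablesAn1S2 3 Lc cΛ) cΛ cB) j) μ ν) =
        B12Normalization.stepBal Nc Lc := by
  have hLc3 : 3 ≤ Lc := by obtain ⟨k, hk⟩ := hLc; omega
  have hNr : (N : ℝ) ≠ 0 := Nat.cast_ne_zero.mpr (by omega)
  have hL : (Lc : ℝ) ≠ 0 := Nat.cast_ne_zero.mpr (NeZero.ne Lc)
  -- the periods of the face reads: `P m = Lc^(m+1)`
  set P : ℕ → ℕ := fun m => Lc ^ (m + 1) with hPdef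
  have hP0 : P 0 = Lc := by simp [hPdef]
  have hPs : ∀ m, P (m + 1) = Lc * P m := fun m => by simp [hPdef, pow_succ]; ring
  have hWn : ∀ (a b : Fin (3 + 1)), a ≠ b → ∀ m : ℕ,
      (fun (m : ℕ) (a₀ b₀ : Fin (3 + 1)) => -4 * (Lc : ℝ) ^ 8 * ((((Lc * P m : ℕ) : ℝ)) ^ 2 - 1)) m a b
        = -4 * (Lc : ℝ) ^ 8 * ((Lc : ℝ) ^ 2 - 1) - 32 * (N : ℝ) ^ 2 * (Lc : ℝ) ^ 8 * (8 * (N : ℝ) ^ 2)⁻¹ * (Lc : ℝ) ^ 2 * (((P m : ℕ) : ℝ) ^ 2 - 1) := by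
    intro a b _ m
    show -4 * (Lc : ℝ) ^ 8 * ((((Lc * P m : ℕ) : ℝ)) ^ 2 - 1) = _
    push_cast
    field_simp
    ring
  exact d1Drift_JsB12CombShSym_an1_iff_lim_eq_of_sRows_faceShapes_cellLaw_law hLc hLc2 hN hΛ hcB hS hSall hδS hθS0 hθS1 P hP0 hPs
    (fun (k n : ℕ) (a₀ b₀ : Fin (3 + 1)) => ((Lc : ℝ) ^ (8 + 8 * k) * ((∑ yy ∈ box (3 + 1) (P n), ∑ al : Fin (3 + 1),
              ((if al = b₀ then ((((P n : ℕ) : ℝ))⁻¹ * (((P n : ℕ) : ℝ))⁻¹) * ((((toSite yy a₀ % ((P n : ℕ) : ℤ)) : ℤ) : ℝ) - (((P n : ℕ) : ℝ) - 1) / 2) else 0)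
                + (if al = a₀ then (-(((P n : ℕ) : ℝ))⁻¹ * ((((toSite yy b₀ % ((P n : ℕ) : ℤ)) : ℤ) : ℝ) - (((P n : ℕ) : ℝ) - 1) / 2)) *
                    (if toSite yy a₀ % ((P n : ℕ) : ℤ) = ((P n : ℕ) : ℤ) - 1 then (1 : ℝ) else 0) else 0)) *
              ∑' ss : Site (3 + 1), ∑ bl : Fin (3 + 1), E2 3 Lc k (toSite yy) ss (Sum.inl al) (Sum.inl bl) *
                ((if bl = a₀ then ((((P n : ℕ) : ℝ))⁻¹ * (((P n : ℕ) : ℝ))⁻¹) * ((((ss b₀ % ((P n : ℕ) : ℤ)) : ℤ) : ℝ) - (((P n : ℕ) : ℝ) - 1) / 2) else 0)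
                  + (if bl = b₀ then (-(((P n : ℕ) : ℝ))⁻¹ * ((((ss a₀ % ((P n : ℕ) : ℤ)) : ℤ) : ℝ) - (((P n : ℕ) : ℝ) - 1) / 2)) *
                      (if ss b₀ % ((P n : ℕ) : ℤ) = ((P n : ℕ) : ℤ) - 1 then (1 : ℝ) else 0) else 0)))
            + (∑ yy ∈ box (3 + 1) (P n), ∑ al : Fin (3 + 1),
              ((if al = a₀ then ((((P n : ℕ) : ℝ))⁻¹ * (((P n : ℕ) : ℝ))⁻¹) * ((((toSite yy b₀ % ((P n : ℕ) : ℤ)) : ℤ) : ℝ) - (((P n : ℕ) : ℝ) - 1) / 2) else 0)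
                + (if al = b₀ then (-(((P n : ℕ) : ℝ))⁻¹ * ((((toSite yy a₀ % ((P n : ℕ) : ℤ)) : ℤ) : ℝ) - (((P n : ℕ) : ℝ) - 1) / 2)) *
                    (if toSite yy b₀ % ((P n : ℕ) : ℤ) = ((P n : ℕ) : ℤ) - 1 then (1 : ℝ) else 0) else 0)) *
              ∑' ss : Site (3 + 1), ∑ bl : Fin (3 + 1), E2 3 Lc k (toSite yy) ss (Sum.inl al) (Sum.inl bl) *
                ((if bl = b₀ then ((((P n : ℕ) : ℝ))⁻¹ * (((P n : ℕ) : ℝ))⁻¹) * ((((ss a₀ % ((P n : ℕ) : ℤ)) : ℤ) : ℝ) - (((P n : ℕ) : ℝ) - 1) / 2) else 0)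
                  + (if bl = a₀ then (-(((P n : ℕ) : ℝ))⁻¹ * ((((ss b₀ % ((P n : ℕ) : ℤ)) : ℤ) : ℝ) - (((P n : ℕ) : ℝ) - 1) / 2)) *
                      (if ss a₀ % ((P n : ℕ) : ℤ) = ((P n : ℕ) : ℤ) - 1 then (1 : ℝ) else 0) else 0))))))
    (fun (m : ℕ) (a₀ b₀ : Fin (3 + 1)) => -4 * (Lc : ℝ) ^ 8 * ((((Lc * P m : ℕ) : ℝ)) ^ 2 - 1))
    (fun a b hab k m => hface_comb_an1 cΛ cB hP0 hPs a b hab k m) (fun a b hab m => hface0_comb_an1 cΛ cB hP0 hPs a b hab m) hWn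
    (fun a b hab i => hcell_comb_an1 hLc hLc3 cΛ cB hP0 a b hab i) γ h hhL hh R2 hR2c hR2p hlaw μ ν Nc

end Summit.QuantumFields.BalabanUV.Beta.GAN24.CombChargeRowsClosed

end
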